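import Literature.Topology.FourManifolds.SliceGenusConcordance
import Literature.Topology.FourManifolds.NeckCapping
import Literature.Topology.FourManifolds.DehnSurgeryTubularNbhdProofs
import HarnessLib

/-!
# Puncturing a slice disc which is flat near its centre: slice ⇒ concordant to the unknot

Topic `Literature/Topology/FourManifolds`; a brick of the discharge of the named fact
`Literature.Topology.FourManifolds.Knot.isSmoothlySlice_iff_isConcordant_unknot` of `SliceRibbon.lean`
(R. H. Fox, J. W. Milnor, *Singularities of 2-spheres in 4-space and cobordism of knots*, Osaka J.
Math. 3 (1966), §3, Thm. 3 and p. 265; C. Livingston, *A survey of classical knot concordance*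
(2005), §1, §2.1), direction "slice ⇒ concordant to the unknot", for slice discs already in
normal form near the centre. Proved here, with no named facts:

* `Literature.Topology.FourManifolds.Knot.IsSliceDisc.isConcordant_unknot_of_flat`: if `K` has a
  slice disc `g` (`Knot.IsSliceDisc K g`) which is **flat near the centre**, `g y = flatDisc y`
  (`= (y₀, y₁, 0, 0)`) for `‖y‖ ≤ ρ`, then `K` is concordant to the unknot.

The reduction of an arbitrary slice disc to this normal form (by compactly supported ambient
diffeomorphisms of the open ball: homogeneity, local linearisation, `GL⁺(4)` is connected) is the
sequel; together with `SliceDiscOfConcordance.lean` (the converse direction) it discharges the fact.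

## Proof (Fox–Milnor, Thm. 3: remove a small ball around a non-singular point)

Remove from the disc the small flat sub-disc of radius `r₀` and read what is left radially. With
`m > 0` a lower bound of `‖g‖` on the annulus `ρ ≤ ‖y‖ ≤ 1` (compactness and injectivity) and
`r₀ = min (ρ/2) (m/2)`, every point `y` with `r₀ ≤ ‖y‖ ≤ 1` has `r₀ ≤ ‖g y‖ ≤ 1`. Let
`Φ : ℝ⁴ → ℝ⁴` be the radial map `z ↦ Λ(‖z‖) • z/‖z‖` with the affine profile
`Λ(r) = (r + 1 - 2 r₀)/(1 - r₀)` (`Λ(r₀) = 1`, `Λ(1) = 2`, increasing), cut off near the origin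
so as to be `C^∞`, and `μ(t) = r₀ + (1 - r₀)(t - 1)` (`μ(1) = r₀`, `μ(2) = 1`). Then

  `h (x, t) = Φ (g (μ(t) • x))`

is a concordance **from the unknot to `K`** (`Knot.IsConcordance unknot K h`): at `t = 1` it is
`Φ (r₀ • flatDisc x) = flatDisc x = unknot x`, at `t = 2` it is `Φ (K x) = 2 • K x`; it is smooth,
injective on the annulus (injectivity of `g` on `𝔻²`, of `Φ` off the cut-off, of `μ`), an
immersion (chain rule: the polar map `(x, t) ↦ μ(t) • x` has a smooth left inverse, `g` is an
immersion on `𝔻²`, and `DΦ` is injective by the *ray lemma* `fderiv_smul_injective_of_radial`: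
for `F z = m(z) • z` it suffices that `s ↦ (1 + s) m((1 + s) z)` has non-zero derivative at `0`),
takes the open annulus into the open shell (`Λ` maps `(r₀, 1)` onto `(1, 2)`), and is neat at both
ends (the radial derivative of `‖g‖²` is `2 r₀ > 0` on the flat circle and positive on `∂𝔻²` by
neatness of the slice disc). Symmetry of concordance (`Knot.IsConcordant.swap`,
`SliceGenusConcordance.lean`) turns it around.

## References

* R. H. Fox, J. W. Milnor, Osaka J. Math. 3 (1966) 257–267, §3, Thm. 3 (p. 265). [FoxMilnor1966]
* C. Livingston, *A survey of classical knot concordance* (2005), §1, §2.1. [Livingston2005]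

## Design notes

No named facts, no `sorry`, no instances (the tree's `Fact (finrank …)` lemmas are *local*
instances). Local notation `𝔼 n`, `𝕊 n`, `𝔻²` as in `SliceRibbon.lean`.
-/

open scoped Manifold ContDiff Topology
open Function Set Metric

noncomputable section

namespace Literature.Topology.FourManifolds

attribute [local instance] fact_finrank_euclideanSpace_two fact_finrank_euclideanSpace_four

/-- Local notation: `𝔼 n` is the model Euclidean space `EuclideanSpace ℝ (Fin n)`. -/
local notation "𝔼 " n:arg => EuclideanSpace ℝ (Fin n)

/-- Local notation: `𝕊 n` is the unit sphere in `EuclideanSpace ℝ (Fin (n + 1))`. -/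
local notation "𝕊 " n:arg => (Metric.sphere (0 : EuclideanSpace ℝ (Fin (n + 1))) 1)

/-- Local notation: `𝔻²` is the closed unit disc in `ℝ²`. -/
local notation "𝔻²" => Metric.closedBall (0 : EuclideanSpace ℝ (Fin 2)) 1

namespace Knot

namespace Puncture

/-! ### Two general lemmas: radial functions and the ray lemma -/

/-- A `C^∞` function of the norm which vanishes for small arguments is `C^∞` on a real inner
product space (near the origin it is identically zero, elsewhere the norm is smooth); the tree's
`Knot.IsConcordance.contDiff_comp_norm` with an arbitrary threshold. [folklore] -/
theorem contDiff_comp_norm' {E : Type*} [NormedAddCommGroup E] [InnerProductSpace ℝ E]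
    {G : ℝ → ℝ} (hG : ContDiff ℝ ∞ G) {ε : ℝ} (hε : 0 < ε) (h0 : ∀ s ≤ ε, G s = 0) :
    ContDiff ℝ ∞ fun y : E ↦ G ‖y‖ := by
  rw [contDiff_iff_contDiffAt]
  intro y
  by_cases hy : y = 0
  · have hev : (fun z : E ↦ G ‖z‖) =ᶠ[𝓝 y] fun _ ↦ 0 := by
      have hB : Metric.ball (0 : E) ε ∈ 𝓝 y := by
        subst hy
        exact Metric.ball_mem_nhds _ hε
      filter_upwards [hB] with z hz
      exact h0 _ (le_of_lt (mem_ball_zero_iff.1 hz))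
    exact contDiffAt_const.congr_of_eventuallyEq hev
  · exact hG.contDiffAt.comp y (contDiffAt_norm ℝ hy)

/-- **Ray lemma.** For a map of the form `F w = m(w) • w` (rays through the origin go to
themselves) the differential at `z ≠ 0` is injective as soon as `m z ≠ 0` and the radial function
`s ↦ (1 + s) m((1 + s) z)` has non-zero derivative at `s = 0`: a kernel vector is a multiple
`λ z` of `z` (compare the `w`-components), and `DF(z) z = (d/ds)|₀ F((1 + s) z) ≠ 0`. [folklore] -/
theorem fderiv_smul_injective_of_radial {E : Type*} [NormedAddCommGroup E] [NormedSpace ℝ E]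
    {m : E → ℝ} {z : E} (hz : z ≠ 0) (hm : DifferentiableAt ℝ m z) (hm0 : m z ≠ 0) {c : ℝ}
    (hc : c ≠ 0) (hrad : HasDerivAt (fun s : ℝ ↦ (1 + s) * m ((1 + s) • z)) c 0) :
    Injective (fderiv ℝ (fun w ↦ m w • w) z) := by
  have hF : HasFDerivAt (fun w ↦ m w • w)
      (m z • ContinuousLinearMap.id ℝ E + (fderiv ℝ m z).smulRight z) z :=
    hm.hasFDerivAt.smul (hasFDerivAt_id z)
  rw [hF.fderiv]
  -- the radial derivative: `c = m z + Dm(z) z`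
  have hγ : HasDerivAt (fun s : ℝ ↦ (1 + s) • z) z 0 := by
    simpa using ((hasDerivAt_id (0 : ℝ)).const_add 1).smul_const z
  have hmγ : HasDerivAt (fun s : ℝ ↦ m ((1 + s) • z)) (fderiv ℝ m z z) 0 :=
    hm.hasFDerivAt.comp_hasDerivAt_of_eq 0 hγ (by simp)
  have hc' : c = m z + fderiv ℝ m z z := by
    have h2 := ((hasDerivAt_id (0 : ℝ)).const_add 1).mul hmγ
    have h3 := hrad.unique h2
    simpa using h3
  -- kernel vectors are multiples of `z`, and `z` is not in the kernel
  intro v w hvw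
  have h0 : (m z • ContinuousLinearMap.id ℝ E + (fderiv ℝ m z).smulRight z) (v - w) = 0 := by
    rw [map_sub, hvw, sub_self]
  simp only [_root_.add_apply, _root_.smul_apply, ContinuousLinearMap.id_apply,
    ContinuousLinearMap.smulRight_apply] at h0
  -- `v - w = l • z`
  set u := v - w with hu
  have hul : u = (-(fderiv ℝ m z u / m z)) • z := by
    have h1 : m z • u = -(fderiv ℝ m z u • z) := eq_neg_of_add_eq_zero_left h0
    calc u = (m z)⁻¹ • (m z • u) := by rw [smul_smul, inv_mul_cancel₀ hm0, one_smul]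
      _ = (-(fderiv ℝ m z u / m z)) • z := by
        rw [h1, smul_neg, smul_smul, ← neg_smul]
        congr 1
        rw [div_eq_inv_mul]
  set l : ℝ := -(fderiv ℝ m z u / m z) with hl
  have h2 : m z • u + fderiv ℝ m z u • z = (l * (m z + fderiv ℝ m z z)) • z := by
    rw [hul, map_smul, smul_eq_mul, smul_smul, ← add_smul]
    congr 1
    ring
  rw [h2, ← hc'] at h0
  rcases smul_eq_zero.1 h0 with h | h
  · rcases mul_eq_zero.1 h with h | h
    · have huv : v - w = l • z := by rw [← hul]
      rw [h, zero_smul] at huv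
      exact sub_eq_zero.1 huv
    · exact absurd h hc
  · exact absurd h hz

/-! ### The radial map of the ball onto the shell -/

/-- The affine **radial profile** `Λ(r) = (r + 1 - 2 r₀)/(1 - r₀)`: increasing, `Λ(r₀) = 1`,
`Λ(1) = 2`. [folklore] -/
def lam (r₀ r : ℝ) : ℝ :=
  (r + 1 - 2 * r₀) / (1 - r₀)

/-- The **radial factor** `Λ(r)/r`, cut off to `0` for `r ≤ r₀/4` (so that the radial map is
`C^∞` at the origin) and equal to `Λ(r)/r` for `r ≥ r₀/2`. [folklore] -/
def radFactor (r₀ r : ℝ) : ℝ :=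
  Real.smoothTransition (4 * r / r₀ - 1) * ((r + 1 - 2 * r₀) / ((1 - r₀) * r))

/-- The **radial map** `Φ z = (Λ(‖z‖)/‖z‖) • z` of `ℝ⁴` (cut off near the origin): it carries the
sphere of radius `r` (`r ≥ r₀/2`) onto the sphere of radius `Λ(r)`, in particular the punctured
ball `r₀ ≤ ‖z‖ ≤ 1` onto the shell `1 ≤ ‖z‖ ≤ 2`. [folklore] -/
def radMap (r₀ : ℝ) (z : 𝔼 4) : 𝔼 4 :=
  radFactor r₀ ‖z‖ • z

section RadMap

variable {r₀ : ℝ} (hr₀ : 0 < r₀) (hr₀4 : r₀ ≤ 1 / 4)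
include hr₀

/-- `radFactor r = 0` for `r ≤ r₀/4`. [folklore] -/
theorem radFactor_of_le {r : ℝ} (hr : r ≤ r₀ / 4) : radFactor r₀ r = 0 := by
  unfold radFactor
  rw [Real.smoothTransition.zero_of_nonpos, zero_mul]
  rw [sub_nonpos, div_le_one hr₀]
  linarith

/-- `radFactor r = Λ(r)/r` for `r ≥ r₀/2`. [folklore] -/
theorem radFactor_of_ge {r : ℝ} (hr : r₀ / 2 ≤ r) :
    radFactor r₀ r = (r + 1 - 2 * r₀) / ((1 - r₀) * r) := by
  unfold radFactor
  rw [Real.smoothTransition.one_of_one_le, one_mul]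
  rw [le_sub_iff_add_le, le_div_iff₀ hr₀]
  linarith

include hr₀4

/-- `radFactor` is `C^∞` on `ℝ`. [folklore] -/
theorem contDiff_radFactor : ContDiff ℝ ∞ (radFactor r₀) := by
  rw [contDiff_iff_contDiffAt]
  intro r
  rcases lt_or_ge r (r₀ / 4) with hr | hr
  · have hev : radFactor r₀ =ᶠ[𝓝 r] fun _ ↦ 0 := by
      filter_upwards [Iio_mem_nhds hr] with u hu using radFactor_of_le hr₀ hu.le
    exact contDiffAt_const.congr_of_eventuallyEq hev
  · have hr0 : r ≠ 0 := ne_of_gt (by linarith)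
    have h1 : ContDiff ℝ ∞ fun u : ℝ ↦ Real.smoothTransition (4 * u / r₀ - 1) :=
      Real.smoothTransition.contDiff.comp (((contDiff_const.mul contDiff_id).div_const _).sub
        contDiff_const)
    have h2 : ContDiffAt ℝ ∞ (fun u : ℝ ↦ (u + 1 - 2 * r₀) / ((1 - r₀) * u)) r := by
      refine ContDiffAt.div ?_ ?_ ?_
      · exact ((contDiffAt_id.add contDiffAt_const).sub contDiffAt_const)
      · exact contDiffAt_const.mul contDiffAt_id
      · exact mul_ne_zero (ne_of_gt (by linarith)) hr0
    exact h1.contDiffAt.mul h2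

/-- The profile `Λ` is positive on `r ≥ r₀ / 2`. [folklore] -/
theorem lam_pos {r : ℝ} (hr : r₀ / 2 ≤ r) : 0 < lam r₀ r := by
  unfold lam
  exact div_pos (by linarith) (by linarith)

/-- `radFactor r > 0` for `r ≥ r₀/2`. [folklore] -/
theorem radFactor_pos {r : ℝ} (hr : r₀ / 2 ≤ r) : 0 < radFactor r₀ r := by
  rw [radFactor_of_ge hr₀ hr]
  exact div_pos (by linarith) (mul_pos (by linarith) (by linarith))

/-- `radMap` is `C^∞` on `ℝ⁴`. [folklore] -/
theorem contDiff_radMap : ContDiff ℝ ∞ (radMap r₀) :=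
  (contDiff_comp_norm' (contDiff_radFactor hr₀ hr₀4) (by positivity : (0 : ℝ) < r₀ / 4)
    (fun _ hs ↦ radFactor_of_le hr₀ hs)).smul contDiff_id

/-- `‖radMap z‖ = Λ(‖z‖)` for `‖z‖ ≥ r₀/2`. [folklore] -/
theorem norm_radMap {z : 𝔼 4} (hz : r₀ / 2 ≤ ‖z‖) : ‖radMap r₀ z‖ = lam r₀ ‖z‖ := by
  have hz0 : ‖z‖ ≠ 0 := by linarith
  have h1 : (1 : ℝ) - r₀ ≠ 0 := ne_of_gt (by linarith)
  rw [radMap, norm_smul, Real.norm_of_nonneg (radFactor_pos hr₀ hr₀4 hz).le,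
    radFactor_of_ge hr₀ hz, lam]
  field_simp

/-- `Λ(r₀) = 1`. [folklore] -/
theorem lam_self : lam r₀ r₀ = 1 := by
  unfold lam
  rw [div_eq_one_iff_eq (ne_of_gt (by linarith))]
  ring

/-- `Λ(1) = 2`. [folklore] -/
theorem lam_one : lam r₀ 1 = 2 := by
  unfold lam
  rw [div_eq_iff (ne_of_gt (by linarith))]
  ring

/-- `Λ` is strictly increasing. [folklore] -/
theorem lam_lt_lam {r r' : ℝ} (h : r < r') : lam r₀ r < lam r₀ r' := by
  unfold lam
  exact div_lt_div_of_pos_right (by linarith) (by linarith)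

/-- `Λ` is injective. [folklore] -/
theorem lam_injective : Injective (lam r₀) := by
  have : StrictMono (lam r₀) := fun _ _ hab ↦ lam_lt_lam hr₀ hr₀4 hab
  exact this.injective

/-- On the flat circle: `radMap (r₀ • u) = u` for a unit vector `u`. [folklore] -/
theorem radMap_smul_unit {u : 𝔼 4} (hu : ‖u‖ = 1) : radMap r₀ (r₀ • u) = u := by
  have hn : ‖r₀ • u‖ = r₀ := by rw [norm_smul, hu, mul_one, Real.norm_of_nonneg hr₀.le]
  have h1 : (1 : ℝ) - r₀ ≠ 0 := ne_of_gt (by linarith)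
  have h2 : r₀ ≠ 0 := hr₀.ne'
  rw [radMap, hn, radFactor_of_ge hr₀ (by linarith), smul_smul]
  conv_rhs => rw [← one_smul ℝ u]
  congr 1
  field_simp
  ring

/-- On the unit sphere: `radMap u = 2 • u`. [folklore] -/
theorem radMap_unit {u : 𝔼 4} (hu : ‖u‖ = 1) : radMap r₀ u = (2 : ℝ) • u := by
  have h1 : (1 : ℝ) - r₀ ≠ 0 := ne_of_gt (by linarith)
  rw [radMap, hu, radFactor_of_ge hr₀ (by linarith)]
  congr 1
  rw [mul_one, div_eq_iff h1]
  ring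

/-- `radMap` is injective off the cut-off. [folklore] -/
theorem radMap_injOn : InjOn (radMap r₀) {z : 𝔼 4 | r₀ / 2 ≤ ‖z‖} := by
  intro z hz z' hz' h
  have hn : ‖z‖ = ‖z'‖ := by
    have := congrArg (fun w ↦ ‖w‖) h
    simp only [norm_radMap hr₀ hr₀4 hz, norm_radMap hr₀ hr₀4 hz'] at this
    exact lam_injective hr₀ hr₀4 this
  simp only [radMap, hn] at h
  exact smul_right_injective (𝔼 4) (radFactor_pos hr₀ hr₀4 hz').ne' h

/-- The differential of `radMap` is injective off the cut-off (ray lemma: the radial function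
`s ↦ (1 + s) Λ((1 + s) r)/((1 + s) r)` is affine with slope `1/(1 - r₀) ≠ 0`). [folklore] -/
theorem fderiv_radMap_injective {z : 𝔼 4} (hz : r₀ / 2 < ‖z‖) :
    Injective (fderiv ℝ (radMap r₀) z) := by
  have hr : 0 < ‖z‖ := by linarith
  have hz0 : z ≠ 0 := norm_pos_iff.1 hr
  have h1r : (1 : ℝ) - r₀ ≠ 0 := ne_of_gt (by linarith)
  have hm : DifferentiableAt ℝ (fun w : 𝔼 4 ↦ radFactor r₀ ‖w‖) z :=
    ((contDiff_radFactor hr₀ hr₀4).differentiable (by simp) _).comp z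
      ((contDiffAt_norm (n := ∞) ℝ hz0).differentiableAt (by simp))
  have hm0 : radFactor r₀ ‖z‖ ≠ 0 := (radFactor_pos hr₀ hr₀4 hz.le).ne'
  have hc : (1 - r₀)⁻¹ ≠ 0 := inv_ne_zero h1r
  show Injective (fderiv ℝ (fun w : 𝔼 4 ↦ radFactor r₀ ‖w‖ • w) z)
  refine fderiv_smul_injective_of_radial (m := fun w : 𝔼 4 ↦ radFactor r₀ ‖w‖) hz0 hm hm0 hc ?_
  -- near `s = 0` the radial function is affine in `s`
  have hev : (fun s : ℝ ↦ (1 + s) * radFactor r₀ ‖(1 + s) • z‖) =ᶠ[𝓝 0]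
      fun s ↦ ((1 + s) * ‖z‖ + 1 - 2 * r₀) / ((1 - r₀) * ‖z‖) := by
    have hc1 : Continuous fun s : ℝ ↦ (1 + s) * ‖z‖ := by fun_prop
    have hc2 : Continuous fun s : ℝ ↦ 1 + s := by fun_prop
    have hO : IsOpen {s : ℝ | r₀ / 2 < (1 + s) * ‖z‖ ∧ 0 < 1 + s} :=
      (isOpen_lt continuous_const hc1).inter (isOpen_lt continuous_const hc2)
    have hmem : (0 : ℝ) ∈ {s : ℝ | r₀ / 2 < (1 + s) * ‖z‖ ∧ 0 < 1 + s} := by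
      constructor
      · show r₀ / 2 < (1 + 0) * ‖z‖
        simpa using hz
      · norm_num
    filter_upwards [hO.mem_nhds hmem] with s hs
    obtain ⟨hs1, hs2⟩ := hs
    have hn : ‖(1 + s) • z‖ = (1 + s) * ‖z‖ := by
      rw [norm_smul, Real.norm_of_nonneg hs2.le]
    have hs0 : (1 : ℝ) + s ≠ 0 := hs2.ne'
    rw [hn, radFactor_of_ge hr₀ hs1.le, mul_div_assoc',
      div_eq_div_iff (mul_ne_zero h1r (mul_ne_zero hs0 hr.ne')) (mul_ne_zero h1r hr.ne')]
    ring
  refine HasDerivAt.congr_of_eventuallyEq ?_ hev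
  have h1 : HasDerivAt (fun s : ℝ ↦ ((1 + s) * ‖z‖ + 1 - 2 * r₀) / ((1 - r₀) * ‖z‖))
      ((1 * ‖z‖) / ((1 - r₀) * ‖z‖)) 0 :=
    (((((hasDerivAt_id (0 : ℝ)).const_add 1).mul_const ‖z‖).add_const 1).sub_const
      (2 * r₀)).div_const _
  have heq : (1 * ‖z‖) / ((1 - r₀) * ‖z‖) = (1 - r₀)⁻¹ := by
    rw [one_mul, mul_comm (1 - r₀) ‖z‖, ← div_div, div_self hr.ne', one_div]
  rw [heq] at h1
  exact h1

end RadMap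

/-! ### The source: polar reading of the punctured disc -/

/-- The affine **time-to-radius** function `μ(t) = r₀ + (1 - r₀)(t - 1)` (`μ(1) = r₀`,
`μ(2) = 1`). [folklore] -/
def mu (r₀ t : ℝ) : ℝ :=
  r₀ + (1 - r₀) * (t - 1)

/-- The inverse `μ⁻¹(s) = 1 + (s - r₀)/(1 - r₀)` of `mu`. [folklore] -/
def muInv (r₀ s : ℝ) : ℝ :=
  1 + (s - r₀) / (1 - r₀)

/-- A base point of `𝕊 1` (the junk direction of the origin). [folklore] -/
def basePt : 𝕊 1 := circlePoint 0

/-- The **polar source map** `(x, t) ↦ μ(t) • x : 𝕊 1 × ℝ → ℝ²`, sweeping the annulus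
`r₀ ≤ ‖y‖ ≤ 1` as `t` runs through `[1, 2]`. [folklore] -/
def polarSrc (r₀ : ℝ) (p : (𝕊 1) × ℝ) : 𝔼 2 :=
  mu r₀ p.2 • ((p.1 : 𝕊 1) : 𝔼 2)

/-- The smooth left inverse `y ↦ (y/‖y‖, μ⁻¹(‖y‖))` of `polarSrc` (off the origin). [folklore] -/
def polarSrcInv (r₀ : ℝ) (y : 𝔼 2) : (𝕊 1) × ℝ :=
  (unitDir basePt y, muInv r₀ ‖y‖)

section Source

variable {r₀ : ℝ}

/-- `μ(1) = r₀`. [folklore] -/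
theorem mu_one : mu r₀ 1 = r₀ := by unfold mu; ring

/-- `μ(2) = 1`. [folklore] -/
theorem mu_two : mu r₀ 2 = 1 := by unfold mu; ring

/-- `μ` is continuous. [folklore] -/
theorem continuous_mu : Continuous (mu r₀) := by unfold mu; fun_prop

/-- `μ` has derivative `1 - r₀`. [folklore] -/
theorem hasDerivAt_mu (t : ℝ) : HasDerivAt (mu r₀) (1 - r₀) t := by
  have h := (((hasDerivAt_id t).sub_const 1).const_mul (1 - r₀)).const_add r₀
  simp only [id, mul_one] at h
  exact h

/-- Pointwise formula for `polarSrc`. [folklore] -/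
theorem polarSrc_apply (x : 𝕊 1) (t : ℝ) : polarSrc r₀ (x, t) = mu r₀ t • (x : 𝔼 2) := rfl

/-- `‖polarSrc (x, t)‖ = μ(t)` when `μ(t) ≥ 0`. [folklore] -/
theorem norm_polarSrc (x : 𝕊 1) {t : ℝ} (ht : 0 ≤ mu r₀ t) : ‖polarSrc r₀ (x, t)‖ = mu r₀ t := by
  rw [polarSrc_apply, norm_smul, norm_eq_of_mem_sphere, mul_one, Real.norm_of_nonneg ht]

/-- `polarSrc` is `C^∞`. [folklore] -/
theorem contMDiff_polarSrc : ContMDiff ((𝓡 1).prod 𝓘(ℝ, ℝ)) 𝓘(ℝ, 𝔼 2) ∞ (polarSrc r₀) := by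
  have h1 : ContMDiff ((𝓡 1).prod 𝓘(ℝ, ℝ)) 𝓘(ℝ, ℝ) ∞ fun p : (𝕊 1) × ℝ ↦ mu r₀ p.2 := by
    have : ContDiff ℝ ∞ (mu r₀) := by
      unfold mu
      exact contDiff_const.add (contDiff_const.mul (contDiff_id.sub contDiff_const))
    exact this.contMDiff.comp contMDiff_snd
  exact h1.smul ((contMDiff_coe_sphere (n := 1)).comp contMDiff_fst)

/-- `polarSrcInv` is `C^∞` at every nonzero point. [folklore] -/
theorem contMDiffAt_polarSrcInv {y : 𝔼 2} (hy : y ≠ 0) :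
    ContMDiffAt 𝓘(ℝ, 𝔼 2) ((𝓡 1).prod 𝓘(ℝ, ℝ)) ∞ (polarSrcInv r₀) y := by
  have h1 : ContMDiffAt 𝓘(ℝ, 𝔼 2) (𝓡 1) ∞ (unitDir basePt) y :=
    (contMDiffOn_unitDir basePt y hy).contMDiffAt (isOpen_compl_singleton.mem_nhds hy)
  have h2 : ContMDiffAt 𝓘(ℝ, 𝔼 2) 𝓘(ℝ, ℝ) ∞ (fun y : 𝔼 2 ↦ muInv r₀ ‖y‖) y := by
    have hμ : ContDiff ℝ ∞ (muInv r₀) := by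
      unfold muInv
      exact contDiff_const.add ((contDiff_id.sub contDiff_const).div_const _)
    exact (hμ.contDiffAt.comp y (contDiffAt_norm ℝ hy)).contMDiffAt
  exact h1.prodMk h2

variable (hr₀ : 0 < r₀) (hr₀4 : r₀ ≤ 1 / 4)
include hr₀ hr₀4

/-- `μ⁻¹ ∘ μ = id`. [folklore] -/
theorem muInv_mu (t : ℝ) : muInv r₀ (mu r₀ t) = t := by
  have h1 : (1 : ℝ) - r₀ ≠ 0 := ne_of_gt (by linarith)
  unfold muInv mu
  field_simp
  ring

omit hr₀ in
/-- `μ` maps `[1, 2]` into `[r₀, 1]`. [folklore] -/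
theorem mu_mem {t : ℝ} (ht : t ∈ Icc (1 : ℝ) 2) : mu r₀ t ∈ Icc r₀ 1 := by
  unfold mu
  refine ⟨le_add_of_nonneg_right (mul_nonneg (by linarith) (by linarith [ht.1])), ?_⟩
  have : (1 - r₀) * (t - 1) ≤ 1 - r₀ := mul_le_of_le_one_right (by linarith) (by linarith [ht.2])
  linarith

omit hr₀ in
/-- `μ` maps `(1, 2)` into `(r₀, 1)`. [folklore] -/
theorem mu_mem_Ioo {t : ℝ} (ht : t ∈ Ioo (1 : ℝ) 2) : mu r₀ t ∈ Ioo r₀ 1 := by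
  unfold mu
  refine ⟨lt_add_of_pos_right _ (mul_pos (by linarith) (by linarith [ht.1])), ?_⟩
  have : (1 - r₀) * (t - 1) < 1 - r₀ := mul_lt_of_lt_one_right (by linarith) (by linarith [ht.2])
  linarith

/-- `μ` is injective. [folklore] -/
theorem mu_injective : Injective (mu r₀) := fun t t' h ↦ by
  rw [← muInv_mu hr₀ hr₀4 t, ← muInv_mu hr₀ hr₀4 t', h]

/-- `polarSrcInv ∘ polarSrc = id` where `μ(t) > 0`. [folklore] -/
theorem polarSrcInv_polarSrc {p : (𝕊 1) × ℝ} (hp : 0 < mu r₀ p.2) :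
    polarSrcInv r₀ (polarSrc r₀ p) = p := by
  obtain ⟨x, t⟩ := p
  refine Prod.ext ?_ ?_
  · exact unitDir_smul basePt x hp
  · change muInv r₀ ‖polarSrc r₀ (x, t)‖ = t
    rw [norm_polarSrc x hp.le, muInv_mu hr₀ hr₀4]

/-- The differential of `polarSrc` is injective wherever `μ(t) > 0`. [folklore] -/
theorem mfderiv_polarSrc_injective {p : (𝕊 1) × ℝ} (hp : 0 < mu r₀ p.2) :
    Injective (mfderiv ((𝓡 1).prod 𝓘(ℝ, ℝ)) 𝓘(ℝ, 𝔼 2) (polarSrc r₀) p) := by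
  have hne : polarSrc r₀ p ≠ 0 := by
    obtain ⟨x, t⟩ := p
    rw [← norm_pos_iff, norm_polarSrc x hp.le]
    exact hp
  have hdP : MDifferentiableAt ((𝓡 1).prod 𝓘(ℝ, ℝ)) 𝓘(ℝ, 𝔼 2) (polarSrc r₀) p :=
    contMDiff_polarSrc.mdifferentiableAt (by simp)
  have hdI : MDifferentiableAt 𝓘(ℝ, 𝔼 2) ((𝓡 1).prod 𝓘(ℝ, ℝ)) (polarSrcInv r₀) (polarSrc r₀ p) :=
    (contMDiffAt_polarSrcInv hne).mdifferentiableAt (by simp)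
  have hev : polarSrcInv r₀ ∘ polarSrc r₀ =ᶠ[𝓝 p] id := by
    have hO : IsOpen {q : (𝕊 1) × ℝ | 0 < mu r₀ q.2} :=
      isOpen_lt continuous_const (continuous_mu.comp continuous_snd)
    filter_upwards [hO.mem_nhds hp] with q hq
    exact polarSrcInv_polarSrc hr₀ hr₀4 hq
  have key : (mfderiv 𝓘(ℝ, 𝔼 2) ((𝓡 1).prod 𝓘(ℝ, ℝ)) (polarSrcInv r₀) (polarSrc r₀ p)).comp
      (mfderiv ((𝓡 1).prod 𝓘(ℝ, ℝ)) 𝓘(ℝ, 𝔼 2) (polarSrc r₀) p) =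
      ContinuousLinearMap.id ℝ (TangentSpace ((𝓡 1).prod 𝓘(ℝ, ℝ)) p) := by
    rw [← mfderiv_comp p hdI hdP, hev.mfderiv_eq, mfderiv_id]
  intro v w h
  have h' := congrArg (mfderiv 𝓘(ℝ, 𝔼 2) ((𝓡 1).prod 𝓘(ℝ, ℝ)) (polarSrcInv r₀) (polarSrc r₀ p)) h
  rwa [← ContinuousLinearMap.comp_apply, ← ContinuousLinearMap.comp_apply, key] at h'

end Source

/-! ### The punctured disc as a concordance from the unknot -/

/-- The **punctured disc** `(x, t) ↦ Φ (g (μ(t) • x))`: the slice disc minus its small flat centre,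
read radially from the flat circle (`t = 1`) out to the knot (`t = 2`) and pushed onto the shell by
the radial map. [cite: FoxMilnor1966, §3 Thm. 3] -/
def puncture (r₀ : ℝ) (g : 𝔼 2 → 𝔼 4) (p : (𝕊 1) × ℝ) : 𝔼 4 :=
  radMap r₀ (g (polarSrc r₀ p))

/-- A lower bound for `‖g‖` on the annulus `ρ ≤ ‖y‖ ≤ 1` of a slice disc flat near the centre
(compactness; `g y ≠ 0 = g 0` there by injectivity on `𝔻²`). [folklore] -/
theorem exists_lt_norm_of_flat {K : Knot} {g : 𝔼 2 → 𝔼 4} {ρ : ℝ} (hg : K.IsSliceDisc g)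
    (hρ : 0 < ρ) (hρ1 : ρ ≤ 1) (hflat : ∀ y : 𝔼 2, ‖y‖ ≤ ρ → g y = flatDisc y) :
    ∃ m : ℝ, 0 < m ∧ ∀ y : 𝔼 2, ρ ≤ ‖y‖ → ‖y‖ ≤ 1 → m ≤ ‖g y‖ := by
  obtain ⟨hgs, hginj, -, -, -, -⟩ := hg
  set A : Set (𝔼 2) := {y | ρ ≤ ‖y‖} ∩ closedBall 0 1 with hA
  have hAc : IsCompact A :=
    (isCompact_closedBall (0 : 𝔼 2) 1).inter_left (isClosed_le continuous_const continuous_norm)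
  have hAne : A.Nonempty := by
    refine ⟨((basePt : 𝕊 1) : 𝔼 2), ?_, ?_⟩
    · show ρ ≤ ‖((basePt : 𝕊 1) : 𝔼 2)‖
      rw [norm_eq_of_mem_sphere]; exact hρ1
    · rw [mem_closedBall_zero_iff, norm_eq_of_mem_sphere]
  have hcont : ContinuousOn (fun y ↦ ‖g y‖) A := (hgs.continuous.norm).continuousOn
  obtain ⟨y₀, hy₀A, hy₀⟩ := hAc.exists_isMinOn hAne hcont
  refine ⟨‖g y₀‖, ?_, fun y h1 h2 ↦ hy₀ ⟨h1, mem_closedBall_zero_iff.2 h2⟩⟩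
  rw [norm_pos_iff]
  intro h0
  have hg0 : g 0 = 0 := by rw [hflat 0 (by rw [norm_zero]; exact hρ.le), map_zero]
  have : y₀ = 0 := hginj hy₀A.2 (mem_closedBall_self zero_le_one) (h0.trans hg0.symm)
  have h1 : ρ ≤ ‖y₀‖ := hy₀A.1
  rw [this, norm_zero] at h1
  linarith

/-- **The punctured flat slice disc is a concordance from the unknot to the knot**, for the
inner radius `r₀` at most `ρ/2` and smaller than the minimum of `‖g‖` on `ρ ≤ ‖y‖ ≤ 1`.
[cite: FoxMilnor1966, §3 Thm. 3] -/
theorem isConcordance_puncture [SphereEmbedding.SmoothnessFacts] {K : Knot} {g : 𝔼 2 → 𝔼 4}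
    {ρ r₀ : ℝ} (hg : K.IsSliceDisc g) (hρ2 : ρ ≤ 1 / 2)
    (hflat : ∀ y : 𝔼 2, ‖y‖ ≤ ρ → g y = flatDisc y) (hr₀ : 0 < r₀) (hr₀ρ : r₀ ≤ ρ / 2)
    (hm : ∀ y : 𝔼 2, ρ ≤ ‖y‖ → ‖y‖ ≤ 1 → r₀ < ‖g y‖) :
    IsConcordance unknot K (puncture r₀ g) := by
  have hr₀4 : r₀ ≤ 1 / 4 := by linarith
  obtain ⟨hgs, hginj, hgimm, hgint, hgneat, hgK⟩ := hg
  -- norms of `g` on the annulus `r₀ ≤ ‖y‖ ≤ 1`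
  have hlow : ∀ y : 𝔼 2, r₀ ≤ ‖y‖ → ‖y‖ ≤ 1 → r₀ ≤ ‖g y‖ := by
    intro y h1 h2
    rcases le_or_gt ‖y‖ ρ with h | h
    · rw [hflat y h, norm_flatDisc]; exact h1
    · exact (hm y h.le h2).le
  have hlow' : ∀ y : 𝔼 2, r₀ < ‖y‖ → ‖y‖ ≤ 1 → r₀ < ‖g y‖ := by
    intro y h1 h2
    rcases le_or_gt ‖y‖ ρ with h | h
    · rw [hflat y h, norm_flatDisc]; exact h1
    · exact hm y h.le h2
  -- values of the source map on the annulus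
  have hμpos : ∀ {t : ℝ}, t ∈ Icc (1 : ℝ) 2 → 0 < mu r₀ t := fun ht ↦
    lt_of_lt_of_le hr₀ (mu_mem hr₀4 ht).1
  have hsrc : ∀ (x : 𝕊 1) {t : ℝ}, t ∈ Icc (1 : ℝ) 2 →
      r₀ ≤ ‖polarSrc r₀ (x, t)‖ ∧ ‖polarSrc r₀ (x, t)‖ ≤ 1 := by
    intro x t ht
    rw [norm_polarSrc x (hμpos ht).le]
    exact ⟨(mu_mem hr₀4 ht).1, (mu_mem hr₀4 ht).2⟩
  have hgsrc : ∀ (x : 𝕊 1) {t : ℝ}, t ∈ Icc (1 : ℝ) 2 → r₀ ≤ ‖g (polarSrc r₀ (x, t))‖ :=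
    fun x t ht ↦ hlow _ (hsrc x ht).1 (hsrc x ht).2
  -- smoothness data
  have hgm : ContMDiff 𝓘(ℝ, 𝔼 2) 𝓘(ℝ, 𝔼 4) ∞ g := hgs.contMDiff
  have hΦ := contDiff_radMap hr₀ hr₀4
  refine ⟨?_, ?_, ?_, ?_, ?_, ?_, ?_⟩
  · -- smoothness
    exact hΦ.contMDiff.comp (hgm.comp contMDiff_polarSrc)
  · -- injectivity on the annulus
    rintro ⟨x, t⟩ ⟨-, ht⟩ ⟨x', t'⟩ ⟨-, ht'⟩ h
    have h1 := radMap_injOn hr₀ hr₀4 (show r₀ / 2 ≤ ‖g (polarSrc r₀ (x, t))‖ by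
      linarith [hgsrc x ht]) (show r₀ / 2 ≤ ‖g (polarSrc r₀ (x', t'))‖ by
      linarith [hgsrc x' ht']) h
    have h2 := hginj (mem_closedBall_zero_iff.2 (hsrc x ht).2)
      (mem_closedBall_zero_iff.2 (hsrc x' ht').2) h1
    have h3 : mu r₀ t = mu r₀ t' := by
      rw [← norm_polarSrc x (hμpos ht).le, ← norm_polarSrc x' (hμpos ht').le, h2]
    have htt : t = t' := mu_injective hr₀ hr₀4 h3
    subst htt
    rw [polarSrc_apply, polarSrc_apply] at h2
    have hx : (x : 𝔼 2) = x' := smul_right_injective (𝔼 2) (hμpos ht).ne' h2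
    rw [Subtype.ext hx]
  · -- immersion on the annulus
    rintro ⟨x, t⟩ ⟨-, ht⟩
    have hdP : MDifferentiableAt ((𝓡 1).prod 𝓘(ℝ, ℝ)) 𝓘(ℝ, 𝔼 2) (polarSrc r₀) (x, t) :=
      contMDiff_polarSrc.mdifferentiableAt (by simp)
    have hdg : MDifferentiableAt 𝓘(ℝ, 𝔼 2) 𝓘(ℝ, 𝔼 4) g (polarSrc r₀ (x, t)) :=
      hgm.mdifferentiableAt (by simp)
    have hdΦ : MDifferentiableAt 𝓘(ℝ, 𝔼 4) 𝓘(ℝ, 𝔼 4) (radMap r₀) ((g ∘ polarSrc r₀) (x, t)) :=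
      hΦ.contMDiff.mdifferentiableAt (by simp)
    rw [show puncture r₀ g = radMap r₀ ∘ (g ∘ polarSrc r₀) from rfl,
      mfderiv_comp _ hdΦ (hdg.comp _ hdP), mfderiv_comp _ hdg hdP, mfderiv_eq_fderiv,
      mfderiv_eq_fderiv]
    refine (fderiv_radMap_injective hr₀ hr₀4 ?_).comp
      ((hgimm _ (mem_closedBall_zero_iff.2 (hsrc x ht).2)).comp
        (mfderiv_polarSrc_injective hr₀ hr₀4 (hμpos ht)))
    exact lt_of_lt_of_le (by linarith) (hgsrc x ht)
  · -- the open annulus goes into the open shell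
    intro x t ht
    have ht' : t ∈ Icc (1 : ℝ) 2 := ⟨ht.1.le, ht.2.le⟩
    have hμ := mu_mem_Ioo hr₀4 ht
    have hn : ‖polarSrc r₀ (x, t)‖ = mu r₀ t := norm_polarSrc x (hμpos ht').le
    have hg1 : r₀ < ‖g (polarSrc r₀ (x, t))‖ := hlow' _ (by rw [hn]; exact hμ.1) (by rw [hn]; exact hμ.2.le)
    have hg2 : ‖g (polarSrc r₀ (x, t))‖ < 1 := hgint _ (by rw [hn]; exact hμ.2)
    change 1 < ‖radMap r₀ (g (polarSrc r₀ (x, t)))‖ ∧ ‖radMap r₀ (g (polarSrc r₀ (x, t)))‖ < 2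
    rw [norm_radMap hr₀ hr₀4 (by linarith)]
    constructor
    · calc (1 : ℝ) = lam r₀ r₀ := (lam_self hr₀ hr₀4).symm
        _ < lam r₀ ‖g (polarSrc r₀ (x, t))‖ := lam_lt_lam hr₀ hr₀4 hg1
    · calc lam r₀ ‖g (polarSrc r₀ (x, t))‖ < lam r₀ 1 := lam_lt_lam hr₀ hr₀4 hg2
        _ = 2 := lam_one hr₀ hr₀4
  · -- neatness at both ends
    intro x
    have hx1 : ‖(x : 𝔼 2)‖ = 1 := norm_eq_of_mem_sphere x
    -- the squared radius `N t = ‖g (μ t • x)‖²` and its derivative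
    set N : ℝ → ℝ := fun t ↦ ‖g (mu r₀ t • (x : 𝔼 2))‖ ^ 2 with hN_def
    have hcurve : ∀ t, HasDerivAt (fun t ↦ mu r₀ t • (x : 𝔼 2)) ((1 - r₀) • (x : 𝔼 2)) t :=
      fun t ↦ (hasDerivAt_mu t).smul_const _
    have hgd : ∀ y, DifferentiableAt ℝ g y := fun y ↦ hgs.differentiable (by simp) y
    have hNd : ∀ t, HasDerivAt N
        ((fderiv ℝ (fun y ↦ ‖g y‖ ^ 2) (mu r₀ t • (x : 𝔼 2))) ((1 - r₀) • (x : 𝔼 2))) t := by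
      intro t
      have h1 : DifferentiableAt ℝ (fun y ↦ ‖g y‖ ^ 2) (mu r₀ t • (x : 𝔼 2)) := (hgd _).norm_sq ℝ
      exact h1.hasFDerivAt.comp_hasDerivAt t (hcurve t)
    -- near the ends, `‖puncture (x, t)‖² = Λ(√(N t))²`
    have hformula : ∀ t₀ : ℝ, t₀ ∈ Icc (1 : ℝ) 2 →
        (fun t ↦ ‖puncture r₀ g (x, t)‖ ^ 2) =ᶠ[𝓝 t₀] fun t ↦ lam r₀ (Real.sqrt (N t)) ^ 2 := by
      intro t₀ ht₀
      have hc : Continuous (fun t : ℝ ↦ ‖g (mu r₀ t • (x : 𝔼 2))‖) :=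
        (hgs.continuous.comp (continuous_mu.smul continuous_const)).norm
      have hev : ∀ᶠ t in 𝓝 t₀, r₀ / 2 < ‖g (mu r₀ t • (x : 𝔼 2))‖ :=
        hc.continuousAt.eventually (lt_mem_nhds (lt_of_lt_of_le (by linarith) (hgsrc x ht₀)))
      filter_upwards [hev] with t ht
      change ‖radMap r₀ (g (mu r₀ t • (x : 𝔼 2)))‖ ^ 2 = _
      rw [norm_radMap hr₀ hr₀4 ht.le, hN_def]
      simp only [Real.sqrt_sq (norm_nonneg _)]
    have hderiv : ∀ t₀ : ℝ, t₀ ∈ Icc (1 : ℝ) 2 →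
        0 < (fderiv ℝ (fun y ↦ ‖g y‖ ^ 2) (mu r₀ t₀ • (x : 𝔼 2))) ((1 - r₀) • (x : 𝔼 2)) →
        0 < deriv (fun t ↦ ‖puncture r₀ g (x, t)‖ ^ 2) t₀ := by
      intro t₀ ht₀ hpos
      rw [(hformula t₀ ht₀).deriv_eq]
      set D : ℝ := (fderiv ℝ (fun y ↦ ‖g y‖ ^ 2) (mu r₀ t₀ • (x : 𝔼 2))) ((1 - r₀) • (x : 𝔼 2))
        with hD
      have hgt : r₀ ≤ ‖g (mu r₀ t₀ • (x : 𝔼 2))‖ := by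
        have := hgsrc x ht₀
        rwa [polarSrc_apply] at this
      have hN0 : 0 < N t₀ := by
        simp only [hN_def]
        exact pow_pos (lt_of_lt_of_le hr₀ hgt) 2
      have hsq : HasDerivAt (fun t ↦ Real.sqrt (N t)) (D / (2 * Real.sqrt (N t₀))) t₀ :=
        (hNd t₀).sqrt hN0.ne'
      have hlam : ∀ s, HasDerivAt (lam r₀) (1 / (1 - r₀)) s := fun s ↦ by
        unfold lam
        simpa using (((hasDerivAt_id s).add_const 1).sub_const (2 * r₀)).div_const (1 - r₀)
      have hcomp : HasDerivAt (fun t ↦ lam r₀ (Real.sqrt (N t)) ^ 2)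
          (((2 : ℕ) : ℝ) * lam r₀ (Real.sqrt (N t₀)) ^ (2 - 1) *
            (1 / (1 - r₀) * (D / (2 * Real.sqrt (N t₀))))) t₀ :=
        ((hlam _).comp t₀ hsq).pow 2
      rw [hcomp.deriv]
      have hl : 0 < lam r₀ (Real.sqrt (N t₀)) := by
        refine lam_pos hr₀ hr₀4 ?_
        simp only [hN_def, Real.sqrt_sq (norm_nonneg _)]
        linarith
      have hs : 0 < Real.sqrt (N t₀) := Real.sqrt_pos.2 hN0
      have h1r : 0 < 1 - r₀ := by linarith
      positivity
    constructor
    · -- `t = 1`: the flat circle, `‖g‖² = ‖·‖²` near `r₀ • x`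
      refine hderiv 1 ⟨le_rfl, by norm_num⟩ ?_
      rw [mu_one]
      have hev : (fun y ↦ ‖g y‖ ^ 2) =ᶠ[𝓝 (r₀ • (x : 𝔼 2))] fun y ↦ ‖y‖ ^ 2 := by
        have hO : IsOpen {y : 𝔼 2 | ‖y‖ < ρ} := isOpen_lt continuous_norm continuous_const
        have hmem : r₀ • (x : 𝔼 2) ∈ {y : 𝔼 2 | ‖y‖ < ρ} := by
          simp only [mem_setOf_eq, norm_smul, hx1, mul_one, Real.norm_of_nonneg hr₀.le]
          linarith
        filter_upwards [hO.mem_nhds hmem] with y hy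
        rw [hflat y (le_of_lt hy), norm_flatDisc]
      rw [hev.fderiv_eq, fderiv_norm_sq_apply]
      simp only [FunLike.coe_smul, Pi.smul_apply, innerSL_apply_apply, inner_smul_left,
        inner_smul_right, real_inner_self_eq_norm_sq, hx1, nsmul_eq_mul, Nat.cast_ofNat,
        RCLike.conj_to_real]
      nlinarith
    · -- `t = 2`: the unit circle, neatness of the slice disc
      refine hderiv 2 ⟨by norm_num, le_rfl⟩ ?_
      rw [mu_two, one_smul, map_smul, smul_eq_mul]
      exact mul_pos (by linarith) (hgneat x hx1)
  · -- `t = 1`: the unknot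
    intro x
    have hx1 : ‖(x : 𝔼 2)‖ = 1 := norm_eq_of_mem_sphere x
    change radMap r₀ (g (polarSrc r₀ (x, 1))) = _
    have hr : ‖r₀ • (x : 𝔼 2)‖ ≤ ρ := by
      rw [norm_smul, hx1, mul_one, Real.norm_of_nonneg hr₀.le]; linarith
    rw [polarSrc_apply, mu_one, hflat _ hr, map_smul, ← flatDisc_coe_sphere]
    exact radMap_smul_unit hr₀ hr₀4 (by rw [norm_flatDisc, hx1])
  · -- `t = 2`: the knot, scaled by `2`
    intro x
    change radMap r₀ (g (polarSrc r₀ (x, 2))) = _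
    rw [polarSrc_apply, mu_two, one_smul, hgK x]
    exact radMap_unit hr₀ hr₀4 (norm_eq_of_mem_sphere _)

end Puncture

/-- **A knot with a slice disc flat near the centre is concordant to the unknot**: puncture the
disc at the centre (`Puncture.isConcordance_puncture`, a concordance from the unknot to `K`) and
reverse (`IsConcordant.swap`). Fox–Milnor (1966), §3, Thm. 3 (the converse half: remove a small
ball around a non-singular point of a non-singular disc to get an annulus); Livingston (2005), §1.
[cite: FoxMilnor1966, §3 Thm. 3] -/
theorem IsSliceDisc.isConcordant_unknot_of_flat [SphereEmbedding.SmoothnessFacts] {K : Knot}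
    {g : 𝔼 2 → 𝔼 4} (hg : K.IsSliceDisc g) {ρ : ℝ} (hρ : 0 < ρ) (hρ2 : ρ ≤ 1 / 2)
    (hflat : ∀ y : 𝔼 2, ‖y‖ ≤ ρ → g y = flatDisc y) : K.IsConcordant unknot := by
  obtain ⟨m, hm, hmle⟩ := Puncture.exists_lt_norm_of_flat hg hρ (by linarith) hflat
  set r₀ : ℝ := min (ρ / 2) (m / 2) with hr₀_def
  have hr₀ : 0 < r₀ := lt_min (by positivity) (by positivity)
  have hr₀ρ : r₀ ≤ ρ / 2 := min_le_left _ _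
  have hr₀m : r₀ < m := lt_of_le_of_lt (min_le_right _ _) (by linarith)
  refine IsConcordant.swap ⟨Puncture.puncture r₀ g, Puncture.isConcordance_puncture hg hρ2 hflat hr₀
    hr₀ρ fun y h1 h2 ↦ lt_of_lt_of_le hr₀m (hmle y h1 h2)⟩

end Knot

end Literature.Topology.FourManifolds
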